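import Mathlib

/-!
Sketch for crux-idea `mirabolic-horosphere` on crux PairLPoleJS (stmt-Langlands-19093).
First checkable statements of the line (Mathlib-only vocabulary; not proved here).
-/

open Filter Topology MeasureTheory Set

namespace Summit.Langlands.Langlands.Cruxes.PairLPoleJS.MirabolicHorosphere

/-- **Abelian lemma (horosphere mass ⟹ pole strength).** If `M : ℝ → ℝ` is bounded and measurable on
`(0, ∞)`, decays at `+∞` a little (`t^a |M t| / t` integrable on `[1, ∞)` for some `a > 0`) and
`M t → M₀` as `t → 0⁺`, then `(σ - 1) ∫₀^∞ t^{κ(σ-1)} M(t) dt/t → M₀ / κ` as `σ → 1⁺`.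
In the line: `M = M_φ` = `|φ|²`-mass of the closed mirabolic horosphere `P¹(F)\P¹(𝔸) · a_t`,
`κ = n - 1`, `M₀ = vol · ‖φ‖²` (equidistribution), and the integral is the mirabolic zeta integral
`Z_φ(σ) = ∫_{P(F)\P(𝔸)} |φ|² |det|^{σ-1}`. -/
theorem tendsto_sub_one_mul_integral_rpow_mul
    {M : ℝ → ℝ} {M₀ κ a C : ℝ} (hκ : 0 < κ) (ha : 0 < a)
    (hM : Measurable M) (hbdd : ∀ t ∈ Ioi (0 : ℝ), |M t| ≤ C)
    (hdecay : IntegrableOn (fun t => t ^ a * |M t| / t) (Ici 1))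
    (h0 : Tendsto M (𝓝[>] 0) (𝓝 M₀)) :
    Tendsto (fun σ : ℝ => (σ - 1) * ∫ t in Ioi (0 : ℝ), t ^ (κ * (σ - 1)) * M t / t)
      (𝓝[>] 1) (𝓝 (M₀ / κ)) := by
  sorry

/-- **Transfer to the tree's lower-bound hypothesis.** If `(σ - 1) Z(σ) → m > 0` as `σ → 1⁺` and
`Z = A · J` with `0 ≤ J ≤ Jmax` near `1⁺` (`J` = product of the bad-place Kirillov integrals of the
chosen vector, bounded iff its Kirillov norm is finite), then `A` (= `‖L^{S'}(σ, β ⊗ β̄)‖ / ζ^{S'}(nσ)`)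
satisfies the one-sided real lower bound consumed by
`Literature.NumberTheory.Automorphic.JacquetShalika1981_partialPairL_pole_of_eq_conj_of_lower_bound`. -/
theorem lower_bound_of_tendsto_mul {Z A J : ℝ → ℝ} {m Jmax : ℝ} (hm : 0 < m) (hJmax : 0 < Jmax)
    (hZ : Tendsto (fun σ => (σ - 1) * Z σ) (𝓝[>] 1) (𝓝 m))
    (hfac : ∀ᶠ σ in 𝓝[>] 1, Z σ = A σ * J σ)
    (hJ : ∀ᶠ σ in 𝓝[>] 1, 0 ≤ J σ ∧ J σ ≤ Jmax)
    (hA : ∀ᶠ σ in 𝓝[>] 1, 0 ≤ A σ) :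
    ∃ c : ℝ, 0 < c ∧ ∀ᶠ σ in 𝓝[>] 1, c ≤ (σ - 1) * A σ := by
  refine ⟨m / 2 / Jmax, by positivity, ?_⟩
  have hlt : ∀ᶠ σ in 𝓝[>] 1, m / 2 < (σ - 1) * Z σ :=
    hZ.eventually (lt_mem_nhds (by linarith))
  have hpos : ∀ᶠ σ : ℝ in 𝓝[>] 1, 0 < σ - 1 := by
    filter_upwards [self_mem_nhdsWithin] with σ hσ
    exact sub_pos.mpr hσ
  filter_upwards [hlt, hfac, hJ, hA, hpos] with σ h1 h2 h3 h4 h5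
  rw [h2] at h1
  -- (σ-1) A J > m/2 and J ≤ Jmax ⟹ (σ-1) A ≥ (m/2)/Jmax
  have hAJ : m / 2 < (σ - 1) * A σ * J σ := by nlinarith [h1]
  have hσA : 0 ≤ (σ - 1) * A σ := mul_nonneg h5.le h4
  rw [div_le_iff₀ hJmax]
  nlinarith [h3.1, h3.2, hAJ, hσA]

/-- **De-averaging lemma (compactness on `K`).** `F σ` are the normalised mirabolic zeta integrals
`k ↦ (σ - 1) Z_{φ^k}(σ)` on the compact group `K_∞` (`x₀ = 1`); (i) is the equicontinuity estimate from the
uniform continuity of `|φ|²` (modulus `ω`) and the horosphere volume; (ii) is the tree's K-AVERAGED residue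
theorem `Literature.NumberTheory.Automorphic.tendsto_sub_one_mul_rankinSelbergIntegral` for archimedean test
functions `Φ_∞` concentrating at the base point (their `f = f_Φ`, normalised). Conclusion: the DE-AVERAGED
residue `(σ - 1) Z_φ(σ) → R`. Pure topology/measure theory. -/
theorem tendsto_of_deaveraging {K : Type*} [TopologicalSpace K] [CompactSpace K] [MeasurableSpace K]
    [OpensMeasurableSpace K] (μ : Measure K) [IsFiniteMeasure μ] (x₀ : K)
    {F : ℝ → K → ℝ} {ω : K → ℝ} {C R : ℝ}
    (hω : Continuous ω) (hω0 : ω x₀ = 0)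
    (hF : ∀ σ ∈ Set.Ioo (1 : ℝ) 2, ∀ k, |F σ k - F σ x₀| ≤ ω k + C * (σ - 1))
    (havg : ∀ U ∈ 𝓝 x₀, ∃ f : K → ℝ, Continuous f ∧ (∀ k, 0 ≤ f k) ∧ (∀ k ∉ U, f k = 0) ∧
        ∫ k, f k ∂μ = 1 ∧ (∀ σ ∈ Set.Ioo (1 : ℝ) 2, Integrable (fun k => f k * F σ k) μ) ∧
        Tendsto (fun σ => ∫ k, f k * F σ k ∂μ) (𝓝[>] 1) (𝓝 R)) :
    Tendsto (fun σ => F σ x₀) (𝓝[>] 1) (𝓝 R) := by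
  sorry

/-- **Log-Cesàro to pointwise (card `horosphere-mixing`).** `F t = ⟨(a_t)_* ν_Y, ψ⟩` is the mass of a
test function `ψ` on the translated closed mirabolic horosphere. Mixing of the `a_t`-flow plus Margulis'
thickening give the convergence of the LOG-CESÀRO means (hypothesis `havg`, the transversal `a_s`-direction
being neutral); uniform continuity of `ψ` under right translation gives `hcont`; conclusion: pointwise
equidistribution `F t → L` as `t → 0⁺`. Pure real analysis. -/
theorem tendsto_of_logCesaro {F : ℝ → ℝ} {L : ℝ}
    (hmeas : ∀ t ∈ Set.Ioo (0 : ℝ) 1, ∀ ε > 0, IntegrableOn (fun u => F (t * Real.exp u)) (Set.Icc (-ε) ε))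
    (havg : ∀ ε > 0, Tendsto (fun t => (2 * ε)⁻¹ * ∫ u in Set.Icc (-ε) ε, F (t * Real.exp u))
      (𝓝[>] 0) (𝓝 L))
    (hcont : ∀ δ > 0, ∃ ε > 0, ∀ t ∈ Set.Ioo (0 : ℝ) 1, ∀ u ∈ Set.Icc (-ε) ε,
      |F (t * Real.exp u) - F t| ≤ δ) :
    Tendsto F (𝓝[>] 0) (𝓝 L) := by
  sorry

end Summit.Langlands.Langlands.Cruxes.PairLPoleJS.MirabolicHorosphere
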